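import Mathlib
import Literature.NumberTheory.DiophantineGeometry.AbcWave0
import Literature.Barriers.ABC.BakerMethodBoundsThreeRoutesProofs

/-!
# `UniformSadicTowerFour` (stmt-ABC-14937), line `flat-steep-split` (lead c3): the `ω(abc) ≤ 3` cell of abc is QUASI-POLYNOMIAL — including its balanced three-prime-power part

Theorems file of line `flat-steep-split` for the crux `UniformSadicTowerFour` (route
`IneffectiveSubspace`); port of the kernel-checked strategist workfile
`Cruxes/UniformSadicTowerFour/ThreeSlotQuasiPolynomial.lean` (strategist seat
`planner-cstrat-stmt-ABC-14937-s1-0`, 2026-08-17).  Modulo the route's crux #6 the crux is abc on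
bounded-`ω` cells (`BoundedOmegaABC`: abc with `C(W, ε)` on `{ω(abc) ≤ W}`); `W ≤ 2` is a theorem and
the first open rung is `W = 3` (three-prime triples `r^z = 1 + p^x q^y`, `q^y r^z = 1 + p^x`,
`p^x + q^y = r^z`).  This file is the WALL on that rung.

**What is proved (sorry-free).**  IF every abc triple satisfies the three linear-forms-in-logarithms
bounds of `Literature…Pasten` at threshold `N = 0` (`Pasten.arch_bound`, `Pasten.padic_bound_a`,
`Pasten.padic_bound_c` with `theta_zero_eq`: `Θ_{u,v} = K^(ω(uv)+1) · ∏_{p ∣ uv} log p`), THEN every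
abc triple with `ω(abc) ≤ 3` satisfies
`log c ≤ (16 K⁴ / (log 2)²) · (∏_{p ∣ abc} log p) · log max(e, 2 log c)`
(`threeSlot_quasiPolynomial`), i.e. `log c ≪ (log rad)³ · log log c` on the WHOLE cell `ω(abc) ≤ 3` —
quasi-polynomial abc there.  The three bounds hold at `K = pastenK` under the tree's one named LFL fact
`Dioph.evertseGyory_thm_4_2_1_rat` (= Matveev 2000 + Yu 2007 over `ℚ`, via `pasten2024_thm_2_1`), which
gives the registered stub `threeSlot_quasiPolynomial_of_evertseGyory` (CONDITIONAL on that fact only).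

**Why this is more than the unbalanced wall.**  Route `NegOmegaAtlas` certifies the quasi-polynomial
wall only on the UNBALANCED cell (`min(a,b) ≤ c^(1−η)`, archimedean form) and records for the BALANCED
cell "no linear form in logarithms is small here".  At `ω = 3` that is too pessimistic: a balanced
`ω = 3` triple is three prime powers `{2^k, q^l, r^m}` (pairwise coprime terms `≥ 2` with three primes
in total are prime powers, and one of them is even), and the 2-ADIC form is small — `v₂` of the even
term is the full exponent `k` — while Yu's estimate at `p = 2` carries the harmless factor `2 / log 2`.
So `k · log 2` is quasi-bounded, and then either the even term is `c`, or it dominates the other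
summand (`c < 2^(k+1)`), or it is the small term of the archimedean bound.  The genuinely LFL-dark
corner of the bounded-`ω` atlas therefore starts at `ω = 4`, shape `2^k s^j ± q^l ± r^m = 0` with three
LARGE odd primes.  This does NOT touch exponent `1 + ε` (the wall allows quality as large as
`≍ log rad`): rung 3 of `BoundedOmegaABC` stays open.  Deliberately NOT here: anything at `ω ≥ 4`,
and the kill paths / shape trichotomy of the rung (sibling files of this line).
-/

-- `Summit.<Summit>.<Problem>` is the mandated summit-side namespace (CONVENTIONS §2); for the
-- single-conjunct summit `ABC` the two coincide, so the duplicate `ABC.ABC` is deliberate.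
set_option linter.dupNamespace false

namespace Summit.ABC.ABC.Theorems.UniformSadicTowerFour.ThreeSlotWall

open Literature.NumberTheory.DiophantineGeometry (IsABCTriple)
open Literature.NumberTheory.DiophantineGeometry.Pasten
  (one_le_log_max_exp coprime_right_of_isABCTriple coprime_left_of_isABCTriple)
open Literature.Barriers.ABC (theta_zero_eq prod_log_primeFactors_pos)
open Finset Real

/-! ## Small helpers -/

/-- A product of `log p` over primes `p ≠ 2` is `≥ 1` (each factor is `≥ log 3 > 1`). [folklore] -/
theorem one_le_prod_log {s : Finset ℕ} (hs : ∀ p ∈ s, p.Prime) (h2 : 2 ∉ s) :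
    (1 : ℝ) ≤ ∏ p ∈ s, Real.log p := by
  have h3 : (1 : ℝ) < Real.log 3 := by
    rw [Real.lt_log_iff_exp_lt (by norm_num)]
    exact Real.exp_one_lt_d9.trans (by norm_num)
  refine Finset.prod_induction _ (fun x : ℝ => 1 ≤ x)
    (fun x y hx hy => one_le_mul_of_one_le_of_one_le hx hy) le_rfl fun p hp => ?_
  have hp2 : 2 ≤ p := (hs p hp).two_le
  have hp3 : (3 : ℝ) ≤ p := by
    have : p ≠ 2 := fun h => h2 (h ▸ hp)
    exact_mod_cast (show 3 ≤ p by omega)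
  exact h3.le.trans (Real.log_le_log (by norm_num) hp3)

/-- A product of `log p` over a set of primes containing `2` is `≥ log 2`. [folklore] -/
theorem log_two_le_prod_log {s : Finset ℕ} (hs : ∀ p ∈ s, p.Prime) (h2 : 2 ∈ s) :
    Real.log 2 ≤ ∏ p ∈ s, Real.log p := by
  rw [← Finset.mul_prod_erase s _ h2, Nat.cast_ofNat]
  have h1 : (1 : ℝ) ≤ ∏ p ∈ s.erase 2, Real.log p :=
    one_le_prod_log (fun p hp => hs p (Finset.mem_of_mem_erase hp)) (Finset.notMem_erase 2 s)
  have hl2 : 0 < Real.log 2 := Real.log_pos one_lt_two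
  nlinarith

/-- The prime factors of an abc triple's product split as `primeFactors a ∪ primeFactors (bc)`,
disjointly. [folklore] -/
theorem primeFactors_abc_eq_union {a b c : ℕ} (h : IsABCTriple a b c) :
    (a * b * c).primeFactors = a.primeFactors ∪ (b * c).primeFactors ∧
      Disjoint a.primeFactors (b * c).primeFactors := by
  have habc' : a.Coprime (b * c) := Nat.Coprime.mul_right h.2.2.2 (coprime_left_of_isABCTriple h)
  obtain ⟨ha, hb, habc, -⟩ := h
  have hc : 0 < c := by omega
  refine ⟨?_, habc'.disjoint_primeFactors⟩
  rw [mul_assoc, Nat.primeFactors_mul ha.ne' (by positivity)]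

/-- Dually: `primeFactors (abc) = primeFactors (ab) ∪ primeFactors c`, disjointly. [folklore] -/
theorem primeFactors_abc_eq_union' {a b c : ℕ} (h : IsABCTriple a b c) :
    (a * b * c).primeFactors = (a * b).primeFactors ∪ c.primeFactors ∧
      Disjoint (a * b).primeFactors c.primeFactors := by
  have habc' : (a * b).Coprime c :=
    Nat.Coprime.mul_left (coprime_left_of_isABCTriple h) (coprime_right_of_isABCTriple h)
  obtain ⟨ha, hb, habc, -⟩ := h
  have hc : 0 < c := by omega
  refine ⟨?_, habc'.disjoint_primeFactors⟩
  rw [Nat.primeFactors_mul (by positivity) hc.ne']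

/-- In an abc triple one of `a, b, c` is even. [folklore] -/
theorem two_dvd_abc {a b c : ℕ} (h : IsABCTriple a b c) : 2 ∣ a ∨ 2 ∣ b ∨ 2 ∣ c := by
  obtain ⟨-, -, habc, -⟩ := h
  rcases Nat.even_or_odd a with ha | ha
  · exact Or.inl (even_iff_two_dvd.mp ha)
  rcases Nat.even_or_odd b with hb | hb
  · exact Or.inr (Or.inl (even_iff_two_dvd.mp hb))
  · exact Or.inr (Or.inr (even_iff_two_dvd.mp (habc ▸ Odd.add_odd ha hb)))

/-- **Classification of the balanced part of the cell.** If `a, b ≥ 2` and `ω(abc) ≤ 3`, then each of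
`a, b, c` has exactly one prime factor. [folklore] -/
theorem card_primeFactors_eq_one_of_le_three {a b c : ℕ} (h : IsABCTriple a b c) (ha2 : 2 ≤ a)
    (hb2 : 2 ≤ b) (hω : (a * b * c).primeFactors.card ≤ 3) :
    a.primeFactors.card = 1 ∧ b.primeFactors.card = 1 ∧ c.primeFactors.card = 1 := by
  obtain ⟨hU, hD⟩ := primeFactors_abc_eq_union h
  have hD2 : Disjoint b.primeFactors c.primeFactors := (coprime_right_of_isABCTriple h).disjoint_primeFactors
  obtain ⟨ha, hb, habc, -⟩ := h
  have hc : 0 < c := by omega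
  have hU2 : (b * c).primeFactors = b.primeFactors ∪ c.primeFactors :=
    Nat.primeFactors_mul hb.ne' hc.ne'
  have hcard : (a * b * c).primeFactors.card =
      a.primeFactors.card + b.primeFactors.card + c.primeFactors.card := by
    rw [hU, Finset.card_union_of_disjoint hD, hU2, Finset.card_union_of_disjoint hD2, add_assoc]
  have h1a : 0 < a.primeFactors.card := Finset.card_pos.mpr (Nat.nonempty_primeFactors.mpr ha2)
  have h1b : 0 < b.primeFactors.card := Finset.card_pos.mpr (Nat.nonempty_primeFactors.mpr hb2)
  have h1c : 0 < c.primeFactors.card :=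
    Finset.card_pos.mpr (Nat.nonempty_primeFactors.mpr (by omega))
  omega

/-- A number with exactly one prime factor which is even is the power of two `2^(v₂ x)`:
`primeFactors x = {2}` and `log x = v₂(x) · log 2`. [folklore] -/
theorem primeFactors_eq_and_log_eq_of_card_eq_one {x : ℕ} (hx : x ≠ 0)
    (hcard : x.primeFactors.card = 1) (h2 : 2 ∣ x) :
    x.primeFactors = {2} ∧ Real.log x = (x.factorization 2 : ℕ) * Real.log 2 := by
  obtain ⟨q, hq⟩ := Finset.card_eq_one.mp hcard
  have h2mem : 2 ∈ x.primeFactors := Nat.mem_primeFactors.mpr ⟨Nat.prime_two, h2, hx⟩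
  rw [hq, Finset.mem_singleton] at h2mem
  have hpf : x.primeFactors = {2} := by rw [hq, h2mem]
  have hxeq : x = 2 ^ x.factorization 2 := by
    conv_lhs => rw [← Nat.prod_factorization_pow_eq_self hx]
    rw [Finsupp.prod, Nat.support_factorization, hpf, Finset.prod_singleton]
  refine ⟨hpf, ?_⟩
  conv_lhs => rw [hxeq]
  push_cast
  rw [Real.log_pow]

/-! ## Real-arithmetic steps (isolated so that each elaborates fast) -/

/-- The 2-adic step in real arithmetic: from Yu's shape at `p = 2` with `ω ≤ 2` other primes to
`k·log 2 ≤ (4K³/(log 2)²)·L·Y`. [folklore] -/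
theorem real_two_adic_step {K L Y k : ℝ} {n : ℕ} (hK : 1 ≤ K) (hL : 0 < L) (hY : 1 ≤ Y) (hn : n ≤ 2)
    (hP : k * Real.log 2 < K ^ (n + 1) * (L / Real.log 2) * ((2 / Real.log 2) * (Real.log 2 + Y))) :
    k * Real.log 2 ≤ (4 * K ^ 3 / Real.log 2 ^ 2) * L * Y := by
  have hl2 : 0 < Real.log 2 := Real.log_pos one_lt_two
  have hl2' : Real.log 2 < 1 := Real.log_two_lt_d9.trans (by norm_num)
  have hKn : K ^ (n + 1) ≤ K ^ 3 := pow_le_pow_right₀ hK (by omega)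
  have hY0 : 0 ≤ Y := zero_le_one.trans hY
  have hLl : 0 ≤ L / Real.log 2 := by positivity
  have h2Y : Real.log 2 + Y ≤ 2 * Y := by linarith
  have h1 : K ^ (n + 1) * (L / Real.log 2) * ((2 / Real.log 2) * (Real.log 2 + Y)) ≤
      K ^ 3 * (L / Real.log 2) * ((2 / Real.log 2) * (2 * Y)) := by
    gcongr
  have h2 : K ^ 3 * (L / Real.log 2) * ((2 / Real.log 2) * (2 * Y)) =
      (4 * K ^ 3 / Real.log 2 ^ 2) * L * Y := by
    field_simp
    ring
  linarith

/-- The archimedean step in real arithmetic. [folklore] -/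
theorem real_arch_step {K L Y D : ℝ} {n : ℕ} (hK : 1 ≤ K) (hL : 0 < L) (hY : 1 ≤ Y) (hn : n ≤ 2)
    (hA : D < K ^ (n + 1) * (L / Real.log 2) * Y) : D ≤ (K ^ 3 / Real.log 2) * L * Y := by
  have hl2 : 0 < Real.log 2 := Real.log_pos one_lt_two
  have hKn : K ^ (n + 1) ≤ K ^ 3 := pow_le_pow_right₀ hK (by omega)
  have hY0 : 0 ≤ Y := zero_le_one.trans hY
  have hLl : 0 ≤ L / Real.log 2 := by positivity
  have h1 : K ^ (n + 1) * (L / Real.log 2) * Y ≤ K ^ 3 * (L / Real.log 2) * Y := by gcongr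
  have h2 : K ^ 3 * (L / Real.log 2) * Y = (K ^ 3 / Real.log 2) * L * Y := by
    field_simp
  linarith

/-- The unbalanced (archimedean-only) step in real arithmetic. [folklore] -/
theorem real_unbalanced_step {K L Y D : ℝ} {n : ℕ} (hK : 1 ≤ K) (hL : 0 < L) (hY : 1 ≤ Y) (hn : n ≤ 3)
    (hA : D < K ^ (n + 1) * L * Y) : D ≤ K ^ 4 * L * Y := by
  have hKn : K ^ (n + 1) ≤ K ^ 4 := pow_le_pow_right₀ hK (by omega)
  have hY0 : 0 ≤ Y := zero_le_one.trans hY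
  have h1 : K ^ (n + 1) * L * Y ≤ K ^ 4 * L * Y := by gcongr
  linarith

/-- Bookkeeping of the constants: `K⁴ + 4K³/(log 2)² + K³/log 2 + 1 ≤ 16K⁴/(log 2)²`, multiplied by
`L·Y ≥ 0`. [folklore] -/
theorem real_constants {K L Y : ℝ} (hK : 1 ≤ K) (hL : 0 < L) (hY : 1 ≤ Y) :
    K ^ 4 * L * Y + (4 * K ^ 3 / Real.log 2 ^ 2) * L * Y + (K ^ 3 / Real.log 2) * L * Y + L * Y ≤
      (16 * K ^ 4 / Real.log 2 ^ 2) * L * Y := by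
  have hl2 : 0 < Real.log 2 := Real.log_pos one_lt_two
  have hl2' : Real.log 2 < 1 := Real.log_two_lt_d9.trans (by norm_num)
  have hY0 : 0 ≤ Y := zero_le_one.trans hY
  have hLY0 : 0 ≤ L * Y := mul_nonneg hL.le hY0
  have hK4 : 1 ≤ K ^ 4 := one_le_pow₀ hK
  have hsq : Real.log 2 ^ 2 ≤ 1 := by nlinarith
  have hsq0 : 0 < Real.log 2 ^ 2 := by positivity
  have hK4nn : 0 ≤ K ^ 4 := by positivity
  have h1 : K ^ 4 ≤ K ^ 4 / Real.log 2 ^ 2 := by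
    rw [le_div_iff₀ hsq0]
    exact mul_le_of_le_one_right hK4nn hsq
  have h2 : K ^ 3 / Real.log 2 ≤ K ^ 4 / Real.log 2 ^ 2 := by
    rw [div_le_div_iff₀ hl2 hsq0]
    have hlK : Real.log 2 ≤ K := hl2'.le.trans hK
    have hK3nn : 0 ≤ K ^ 3 * Real.log 2 := by positivity
    calc K ^ 3 * Real.log 2 ^ 2 = (K ^ 3 * Real.log 2) * Real.log 2 := by ring
      _ ≤ (K ^ 3 * Real.log 2) * K := mul_le_mul_of_nonneg_left hlK hK3nn
      _ = K ^ 4 * Real.log 2 := by ring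
  have h3 : (1 : ℝ) ≤ K ^ 4 / Real.log 2 ^ 2 := by
    rw [le_div_iff₀ hsq0, one_mul]
    exact hsq.trans hK4
  have h4 : 4 * K ^ 3 / Real.log 2 ^ 2 ≤ 4 * (K ^ 4 / Real.log 2 ^ 2) := by
    rw [mul_div_assoc]
    exact mul_le_mul_of_nonneg_left
      (div_le_div_of_nonneg_right (pow_le_pow_right₀ hK (by norm_num)) hsq0.le) (by norm_num)
  have hsum : K ^ 4 + 4 * K ^ 3 / Real.log 2 ^ 2 + K ^ 3 / Real.log 2 + 1 ≤
      16 * K ^ 4 / Real.log 2 ^ 2 := by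
    have hX : 0 ≤ K ^ 4 / Real.log 2 ^ 2 := by positivity
    have e : 16 * K ^ 4 / Real.log 2 ^ 2 = 16 * (K ^ 4 / Real.log 2 ^ 2) := by ring
    rw [e]
    linarith
  have hmul := mul_le_mul_of_nonneg_right hsum hLY0
  have e1 : (K ^ 4 + 4 * K ^ 3 / Real.log 2 ^ 2 + K ^ 3 / Real.log 2 + 1) * (L * Y) =
      K ^ 4 * L * Y + (4 * K ^ 3 / Real.log 2 ^ 2) * L * Y + (K ^ 3 / Real.log 2) * L * Y + L * Y := by
    ring
  have e2 : (16 * K ^ 4 / Real.log 2 ^ 2) * (L * Y) = (16 * K ^ 4 / Real.log 2 ^ 2) * L * Y := by ring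
  linarith

/-! ## The wall -/

/-- **Quasi-polynomial abc on the cell `ω(abc) ≤ 3` (including its balanced part).**
Hypotheses = the archimedean and the two `p`-adic linear-forms bounds of `Pasten.arch_bound`,
`Pasten.padic_bound_a`, `Pasten.padic_bound_c` at threshold `N = 0` (`theta_zero_eq`), stated verbatim
in abc language as in route NegOmegaAtlas's supports `UnbalancedQuasiPolynomial` /
`PrimeFloorBoundedOmega`.  Conclusion: `log c ≤ (16K⁴/(log 2)²)·(∏_{p ∣ abc} log p)·log max(e, 2 log c)`
whenever `ω(abc) ≤ 3`.  Proof: if `min(a,b) = 1`, the archimedean bound alone; otherwise `a, b, c` are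
prime powers and the even one is `2^k`, the 2-adic bound gives `k log 2 < Θ·(2/log 2)(log 2 + Y)`, and
either the even term is `c`, or it dominates the other summand (`c < 2^(k+1)`), or it is the small term
of the archimedean bound. [folklore] -/
theorem threeSlot_quasiPolynomial (K : ℝ) (hK : 1 ≤ K)
    (hArch : ∀ a b c : ℕ, IsABCTriple a b c →
      Real.log c - Real.log a < K ^ ((b * c).primeFactors.card + 1) *
        (∏ p ∈ (b * c).primeFactors, Real.log p) * Real.log (max (Real.exp 1) (2 * Real.log c)))
    (hPa : ∀ a b c : ℕ, IsABCTriple a b c → ∀ p : ℕ, p.Prime → p ∣ a →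
      (a.factorization p : ℝ) * Real.log p < K ^ ((b * c).primeFactors.card + 1) *
        (∏ q ∈ (b * c).primeFactors, Real.log q) *
        ((p / Real.log p) * (Real.log p + Real.log (max (Real.exp 1) (2 * Real.log c)))))
    (hPc : ∀ a b c : ℕ, IsABCTriple a b c → 1 < a * b → ∀ p : ℕ, p.Prime → p ∣ c →
      (c.factorization p : ℝ) * Real.log p < K ^ ((a * b).primeFactors.card + 1) *
        (∏ q ∈ (a * b).primeFactors, Real.log q) *
        ((p / Real.log p) * (Real.log p + Real.log (max (Real.exp 1) (2 * Real.log c))))) :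
    ∀ a b c : ℕ, IsABCTriple a b c → (a * b * c).primeFactors.card ≤ 3 →
      Real.log c ≤ (16 * K ^ 4 / Real.log 2 ^ 2) * (∏ p ∈ (a * b * c).primeFactors, Real.log p) *
        Real.log (max (Real.exp 1) (2 * Real.log c)) := by
  have hl2 : 0 < Real.log 2 := Real.log_pos one_lt_two
  -- KEY STEP, for a triple whose even term is `a` or `c`.
  have key : ∀ a b c : ℕ, IsABCTriple a b c → (a * b * c).primeFactors.card ≤ 3 → (2 ∣ a ∨ 2 ∣ c) →
      Real.log c ≤ (16 * K ^ 4 / Real.log 2 ^ 2) * (∏ p ∈ (a * b * c).primeFactors, Real.log p) *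
        Real.log (max (Real.exp 1) (2 * Real.log c)) := by
    intro a b c h hω h2
    have hprimes : ∀ p ∈ (a * b * c).primeFactors, p.Prime :=
      fun p hp => Nat.prime_of_mem_primeFactors hp
    set L : ℝ := ∏ p ∈ (a * b * c).primeFactors, Real.log p with hLdef
    set Y : ℝ := Real.log (max (Real.exp 1) (2 * Real.log c)) with hYdef
    have hY : 1 ≤ Y := one_le_log_max_exp _
    have hY0 : 0 ≤ Y := zero_le_one.trans hY
    have hLpos : 0 < L := prod_log_primeFactors_pos _
    have hconst := real_constants hK hLpos hY
    have hnn1 : 0 ≤ K ^ 4 * L * Y := by positivity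
    have hnn2 : 0 ≤ (4 * K ^ 3 / Real.log 2 ^ 2) * L * Y := by positivity
    have hnn3 : 0 ≤ (K ^ 3 / Real.log 2) * L * Y := by positivity
    have hnn4 : 0 ≤ L * Y := by positivity
    obtain ⟨ha, hb, habc, hcop⟩ := h
    have hc : 0 < c := by omega
    have habc0 : a * b * c ≠ 0 := by positivity
    have h2abc : 2 ∣ a * b * c := by
      rcases h2 with h2 | h2
      · exact Dvd.dvd.mul_right (Dvd.dvd.mul_right h2 b) c
      · exact Dvd.dvd.mul_left h2 (a * b)
    have hL2 : Real.log 2 ≤ L :=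
      log_two_le_prod_log hprimes (Nat.mem_primeFactors.mpr ⟨Nat.prime_two, h2abc, habc0⟩)
    have hLY : Real.log 2 ≤ L * Y := by nlinarith
    by_cases hmin : a = 1 ∨ b = 1
    · -- UNBALANCED CORNER `min(a,b) = 1`: the archimedean bound alone.
      rcases hmin with rfl | rfl
      · have hA := hArch 1 b c ⟨ha, hb, habc, hcop⟩
        rw [Nat.cast_one, Real.log_one, sub_zero] at hA
        have hbc : (b * c).primeFactors = (1 * b * c).primeFactors := by rw [one_mul]
        rw [hbc] at hA
        have := real_unbalanced_step (D := Real.log c) hK hLpos hY hω hA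
        linarith
      · have hA := hArch 1 a c (IsABCTriple.swap ⟨ha, hb, habc, hcop⟩)
        rw [Nat.cast_one, Real.log_one, sub_zero] at hA
        have hac : (a * c).primeFactors = (a * 1 * c).primeFactors := by rw [mul_one]
        rw [hac] at hA
        have := real_unbalanced_step (D := Real.log c) hK hLpos hY hω hA
        linarith
    · -- BALANCED PART: `a, b ≥ 2`, so `a, b, c` are prime powers and the even one is `2^k`.
      push Not at hmin
      have ha2 : 2 ≤ a := by omega
      have hb2 : 2 ≤ b := by omega
      obtain ⟨hca, -, hcc⟩ := card_primeFactors_eq_one_of_le_three ⟨ha, hb, habc, hcop⟩ ha2 hb2 hω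
      rcases h2 with h2a | h2c
      · -- the even term is the summand `a = 2^k`
        obtain ⟨hapf, hloga⟩ := primeFactors_eq_and_log_eq_of_card_eq_one ha.ne' hca h2a
        -- 2-adic bound on `k`
        have hP := hPa a b c ⟨ha, hb, habc, hcop⟩ 2 Nat.prime_two h2a
        simp only [Nat.cast_ofNat] at hP
        obtain ⟨hU, hD⟩ := primeFactors_abc_eq_union ⟨ha, hb, habc, hcop⟩
        have hLsplit : L = Real.log 2 * ∏ p ∈ (b * c).primeFactors, Real.log p := by
          rw [hLdef, hU, Finset.prod_union hD, hapf, Finset.prod_singleton, Nat.cast_ofNat]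
        have hPeq : ∏ p ∈ (b * c).primeFactors, Real.log p = L / Real.log 2 := by
          rw [hLsplit]; field_simp
        have hcardbc : (b * c).primeFactors.card ≤ 2 := by
          have : (a * b * c).primeFactors.card = 1 + (b * c).primeFactors.card := by
            rw [hU, Finset.card_union_of_disjoint hD, hca]
          omega
        rw [hPeq] at hP
        have hk := real_two_adic_step hK hLpos hY hcardbc hP
        rcases le_or_gt a b with hab | hab
        · -- `a ≤ b`: `a` is the small term of the archimedean bound
          have hA := hArch a b c ⟨ha, hb, habc, hcop⟩
          rw [hPeq] at hA
          have hA' := real_arch_step hK hLpos hY hcardbc hA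
          rw [hloga] at hA'
          linarith
        · -- `b < a`: then `c = a + b < 2a = 2^(k+1)`
          have hc2a : (c : ℝ) < 2 * a := by exact_mod_cast (show c < 2 * a by omega)
          have ha0 : (0 : ℝ) < a := by exact_mod_cast ha
          have hlogc : Real.log c < Real.log 2 + (a.factorization 2 : ℕ) * Real.log 2 := by
            rw [← hloga, ← Real.log_mul (by norm_num) ha0.ne']
            exact Real.log_lt_log (by exact_mod_cast hc) hc2a
          linarith
      · -- the even term is `c = 2^k`
        obtain ⟨hcpf, hlogc⟩ := primeFactors_eq_and_log_eq_of_card_eq_one hc.ne' hcc h2c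
        have hab1 : 1 < a * b := by
          have : 2 * 2 ≤ a * b := Nat.mul_le_mul ha2 hb2
          omega
        have hP := hPc a b c ⟨ha, hb, habc, hcop⟩ hab1 2 Nat.prime_two h2c
        simp only [Nat.cast_ofNat] at hP
        obtain ⟨hU, hD⟩ := primeFactors_abc_eq_union' ⟨ha, hb, habc, hcop⟩
        have hLsplit : L = (∏ p ∈ (a * b).primeFactors, Real.log p) * Real.log 2 := by
          rw [hLdef, hU, Finset.prod_union hD, hcpf, Finset.prod_singleton, Nat.cast_ofNat]
        have hPeq : ∏ p ∈ (a * b).primeFactors, Real.log p = L / Real.log 2 := by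
          rw [hLsplit]; field_simp
        have hcardab : (a * b).primeFactors.card ≤ 2 := by
          have : (a * b * c).primeFactors.card = (a * b).primeFactors.card + 1 := by
            rw [hU, Finset.card_union_of_disjoint hD, hcc]
          omega
        rw [hPeq] at hP
        have hk := real_two_adic_step hK hLpos hY hcardab hP
        rw [hlogc]
        linarith
  -- MAIN: the even term is `a`, `b` or `c`; if it is `b`, swap the summands.
  intro a b c h hω
  rcases two_dvd_abc h with h2 | h2 | h2
  · exact key a b c h hω (Or.inl h2)
  · have hswap : b * a * c = a * b * c := by ring
    have := key b a c h.swap (by rw [hswap]; exact hω) (Or.inl h2)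
    rwa [hswap] at this
  · exact key a b c h hω (Or.inr h2)

/-! ## Discharge down to the tree's one named LFL fact -/

open Literature.NumberTheory.DiophantineGeometry.Dioph
  (evertseGyory_thm_4_2_1_rat pastenK one_le_pastenK pasten2024_thm_2_1)
open Literature.NumberTheory.DiophantineGeometry.Pasten (arch_bound padic_bound_a padic_bound_c)

/-- **The `ω ≤ 3` quasi-polynomial wall, conditional only on Evertse–Győry Thm 4.2.1 over `ℚ`**
(= Matveev 2000 + Yu 2007, the named fact every in-tree linear-forms consequence rests on:
`Dioph.evertseGyory_thm_4_2_1_rat`; `pasten2024_thm_2_1` turns it into `PastenApproximationBound pastenK`,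
and `Pasten.arch_bound / padic_bound_a / padic_bound_c` at `N = 0` with `theta_zero_eq` are exactly the
three hypotheses of `threeSlot_quasiPolynomial`).  So on the cell `ω(abc) ≤ 3`:
`log c ≤ (16·pastenK⁴/(log 2)²) · (∏_{p ∣ abc} log p) · log max(e, 2 log c)`.
[cite: EvertseGyory2015, Theorem 4.2.1 (p. 68)] [cite: Pasten2024, Theorem 2.1] -/
theorem threeSlot_quasiPolynomial_of_evertseGyory (hEG : evertseGyory_thm_4_2_1_rat) :
    ∀ a b c : ℕ, IsABCTriple a b c → (a * b * c).primeFactors.card ≤ 3 →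
      Real.log c ≤ (16 * pastenK ^ 4 / Real.log 2 ^ 2) * (∏ p ∈ (a * b * c).primeFactors, Real.log p) *
        Real.log (max (Real.exp 1) (2 * Real.log c)) := by
  have hK := one_le_pastenK
  have hP := pasten2024_thm_2_1 hEG
  refine threeSlot_quasiPolynomial pastenK hK ?_ ?_ ?_
  · intro a b c h
    have hc : c ≠ 0 := by obtain ⟨ha, -, habc, -⟩ := h; omega
    have := arch_bound hK hP h 0
    rwa [theta_zero_eq pastenK h.2.1.ne' hc (coprime_right_of_isABCTriple h)] at this
  · intro a b c h p hp hpa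
    have hc : c ≠ 0 := by obtain ⟨ha, -, habc, -⟩ := h; omega
    have := padic_bound_a hK hP h 0 hp hpa
    rwa [theta_zero_eq pastenK h.2.1.ne' hc (coprime_right_of_isABCTriple h)] at this
  · intro a b c h h1 p hp hpc
    have := padic_bound_c hK hP h h1 0 hp hpc
    rwa [theta_zero_eq pastenK h.1.ne' h.2.1.ne' h.2.2.2] at this

end Summit.ABC.ABC.Theorems.UniformSadicTowerFour.ThreeSlotWall
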